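import Literature.AlgebraicGeometry.HodgeTheory.AlgebraicCechDeRham
import Literature.AlgebraicGeometry.HodgeTheory.RegularFormRealizationOnOpens
import Literature.Geometry.Kaehler.CechDeRham
import Literature.Algebra.Homology.DoubleComplexNaturality
import HarnessLib

/-!
# Realisation of the algebraic Čech–de Rham complex of an affine cover in the smooth one

[topic AlgebraicGeometry/HodgeTheory]

Let `X` be a smooth `ℂ`-scheme with analytic model `A` (`X^an = A.carrier`, `ψ : X^an → X(ℂ)`),
`𝔘 = (U_i)_{i ∈ ι}` a family of opens with AFFINE finite intersections `U_J` (`IsAffineCover U`),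
and `C : CoverCharts X U` onto presentations of the `U_J` (`AlgebraicCechDeRham`: the algebraic
Čech–de Rham double complex `K^{p,q}_alg = Č^p(𝔘, Ω^q_alg)`, `C.cechDeRham`). The open pieces
`𝔘^an = (ψ⁻¹ U_i(ℂ))_i` cover `X^an` by the open sets `A.coverSet U i`, whose finite intersections
are the open pieces `ψ⁻¹ U_J(ℂ) = A.openSet (cechOpen U J)` (`cechSet_coverSet`), the carriers of
the analytic models `A.restrictOpen U_J`. Grothendieck's comparison map on each `U_J`, read as a
local form on `X^an` (`AnalyticModel.localRealize`, `RegularFormRealizationOnOpens`), assembles to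

* **`CoverCharts.realizeHom A C`** — a MORPHISM OF DOUBLE COMPLEXES
  `K_alg = Č(𝔘, Ω_alg) → K_an = Č(𝔘^an, Ω_smooth)` (the tree's smooth Čech–de Rham complex
  `Geometry.Kaehler.cechDeRham` of [BottTu1982Forms, §8]) over `ℝ` (`C.cechDeRhamℝ`, the algebraic
  complex with scalars restricted to `ℝ`): it commutes with `d` by `localD_localRealize` and with
  the Čech differentials by `restrictₗ_localRealize` (naturality of the comparison map along the
  inclusions `U_J ⊆ U_{J∘σ_j}`, node P2-nat) — El Zein–Tu's «similar computation … compatibly with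
  the restriction maps» [CattaniElZeinGriffithsLe2014, Ch. 2 §2.9.2 (p. 109)], i.e. the map of the
  spectral sequences (6) of [Grothendieck1966, p. 96];
* `CoverCharts.realizeTotCohMap A C n : Hⁿ(Tot K_alg) → Hⁿ(Tot K_an)` — the induced map on total
  cohomology (`ADoubleComplex.Hom.totCohMap`);
* `CoverCharts.realizeDeRham A C hcov n : Hⁿ(Tot K_alg) → Hⁿ(Ω•(X^an), d)` — for a finite cover
  `⋃ 𝔘^an = X^an`, the composite with the inverse of the edge isomorphism
  `Hⁿ(Ω•(X^an)) ≅ Hⁿ(Tot K_an)` of the smooth complex (rows exact by a partition of unity,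
  [BottTu1982Forms, Prop. 8.5 / Prop. 8.8], the tree's `cechDeRham_rowExact` / `cechDeRhamRow_exact`):
  the REALISATION MAP of Route P (node P2: `alg-ČdR(𝔘) → smooth-ČdR(𝔘^an) → A•(X^an)`); its
  reading in `complexDeRhamCohomology E X^an n` (the carrier of `deRhamComparison`) is the
  composite with `Geometry/Kaehler/LocalFormsCohomologyComparison.localCohomologyEquivComplexDeRham`
  (separate file).

Everything is proved; definitions with bodies; no named facts (net debt 0).

## References

* [Grothendieck1966] A. Grothendieck, *On the de Rham cohomology of algebraic varieties*, Publ.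
  Math. IHÉS 29 (1966), p. 96 (5)–(6).
* [CattaniElZeinGriffithsLe2014] E. Cattani, F. El Zein, P. Griffiths, Lê D. T. (eds.), *Hodge
  Theory*, Princeton Math. Notes 49 (2014), Ch. 2 (F. El Zein, L. Tu), §2.9.2, p. 109.
* [BottTu1982Forms] R. Bott, L. W. Tu, *Differential Forms in Algebraic Topology*, §8, Prop. 8.5,
  Prop. 8.8.
* [Weibel1994] C. Weibel, *An Introduction to Homological Algebra*, 1.2.4–1.2.6, Lemma 2.7.3.
-/

noncomputable section

universe u

open scoped Manifold ContDiff Topology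
open Set CategoryTheory AlgebraicGeometry MvPolynomial
open Literature.Algebra.Homology Literature.Geometry.Kaehler Literature.NumberTheory.Transcendental
open Literature.AlgebraicGeometry.Motives Literature.AlgebraicGeometry.Motives.AffineDeRham

namespace Literature.AlgebraicGeometry.HodgeTheory

section HodgeTheory

variable {X : Motives.SchemeOver ℂ} {ι : Type u}

/-! ### Affine covers -/

/-- **A family of opens with affine finite intersections** (e.g. any affine open cover of a separated
scheme [Hartshorne1977, II Ex. 4.3]; the standard cover of a projective variety), as a class so that
the affine pieces `X|_{U_J}` carry `IsAffine` instances. [cite: CattaniElZeinGriffithsLe2014, Ch. 2 §2.9.2 (p. 109)] -/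
class IsAffineCover (U : ι → X.left.Opens) : Prop where
  /-- every finite intersection `U_J` is an affine open -/
  isAffineOpen : ∀ {p : ℕ} (J : Fin (p + 1) → ι), IsAffineOpen (cechOpen U J)

/-- The pieces `X|_{U_J}` of an affine cover are affine schemes. [cite: Hartshorne1977, II Ex. 4.3] -/
instance isAffine_cechScheme_left {U : ι → X.left.Opens} [h : IsAffineCover U] {p : ℕ}
    (J : Fin (p + 1) → ι) : IsAffine (cechScheme X U J).left :=
  h.isAffineOpen J

/-- Charts of an affine cover of a `ℂ`-scheme of finite type (choice, `CoverCharts.ofIsAffineOpen`).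
[cite: Hartshorne1977, II §3] -/
def CoverCharts.ofIsAffineCover (U : ι → X.left.Opens) [IsAffineCover U] [LocallyOfFiniteType X.hom] :
    CoverCharts X U :=
  CoverCharts.ofIsAffineOpen (IsAffineCover.isAffineOpen (U := U))

/-! ### The open pieces of the analytic model over the cover -/

variable {E : Type} [NormedAddCommGroup E] [NormedSpace ℂ E] [FiniteDimensional ℂ E] {m : ℕ}

namespace AnalyticModel

variable (A : AnalyticModel E m X) (U : ι → X.left.Opens)

/-- The open cover `𝔘^an = (ψ⁻¹ U_i(ℂ))_i` of `X^an` by the open pieces, as sets.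
[cite: SerreGAGA1956, §2 n°5] -/
def coverSet : ι → Set A.carrier :=
  fun i ↦ (A.openSet (U i) : Set A.carrier)

/-- The open pieces are open. [cite: SerreGAGA1956, §2 n°5] -/
theorem isOpen_coverSet : ∀ i, IsOpen (A.coverSet U i) :=
  fun i ↦ (A.openSet (U i)).isOpen

/-- **Finite intersections of open pieces are the open pieces of the finite intersections**:
`⋂_k ψ⁻¹ U_{J k}(ℂ) = ψ⁻¹ U_J(ℂ)`. [cite: SerreGAGA1956, §2 n°5] -/
theorem cechSet_coverSet {n : ℕ} (J : Fin n → ι) :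
    cechSet (A.coverSet U) J = (A.openSet (cechOpen U J) : Set A.carrier) := by
  ext z
  rw [mem_cechSet_iff, SetLike.mem_coe, A.mem_openSet_iff, mem_cechOpen_iff]
  exact forall_congr' fun k ↦ A.mem_openSet_iff (U (J k)) z

/-- If the `U_i` cover `X` then the open pieces cover `X^an`. [cite: SerreGAGA1956, §2 n°5] -/
theorem iUnion_coverSet (hU : ⨆ i, U i = ⊤) : ⋃ i, A.coverSet U i = univ := by
  refine eq_univ_of_forall fun z ↦ mem_iUnion.2 ?_
  have hz : (A.toComplexPoints z).pt ∈ (⨆ i, U i) := by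
    rw [hU]
    trivial
  obtain ⟨i, hi⟩ := TopologicalSpace.Opens.mem_iSup.1 hz
  exact ⟨i, (A.mem_openSet_iff (U i) z).2 hi⟩

/-- For a finite cover `⋃ 𝔘^an = X^an` the augmented rows of the smooth Čech–de Rham complex of the
open pieces are exact (partition of unity, Bott–Tu Prop. 8.5), so its edge map
`Hⁿ(Ω•(X^an)) → Hⁿ(Tot Č(𝔘^an, Ω))` is an isomorphism (Bott–Tu Prop. 8.8) — the tree's
`cechDeRham_rowExact` / `cechDeRhamRow_exact` instantiated on `X^an`. [cite: BottTu1982Forms, Prop. 8.8] -/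
theorem bijective_cechDeRhamRow_totMap [Fintype ι] (hU : ⨆ i, U i = ⊤) (n : ℕ) :
    Function.Bijective
      ((Literature.Geometry.Kaehler.cechDeRhamRow 𝓘(ℝ, E) ℂ (A.isOpen_coverSet U)).totMap n) := by
  have hcov := A.iUnion_coverSet U hU
  have hρ := (SmoothPartitionOfUnity.exists_isSubordinate 𝓘(ℝ, E) isClosed_univ (A.coverSet U)
    (A.isOpen_coverSet U) hcov.symm.subset).choose_spec
  exact (Literature.Geometry.Kaehler.cechDeRhamRow 𝓘(ℝ, E) ℂ (A.isOpen_coverSet U)).bijective_totMap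
    (Literature.Geometry.Kaehler.cechDeRham_rowExact (A.isOpen_coverSet U) _ hρ)
    (Literature.Geometry.Kaehler.cechDeRhamRow_exact (A.isOpen_coverSet U) _ hρ fun y ↦
      mem_iUnion.1 (hcov.symm.subset (mem_univ y))) n

end AnalyticModel

/-! ### The global realisation on an affine `X` restricted to the open pieces -/

omit [FiniteDimensional ℂ E] in
/-- Extension by zero of the restriction of a form on `X^an` to an open piece is the cut-off of the
form to that piece. [cite: BottTu1982Forms, §I.1] -/
theorem _root_.Literature.Geometry.Kaehler.MForm.extendZero_pullback_subtypeVal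
    {E' : Type*} [NormedAddCommGroup E'] [NormedSpace ℝ E'] {F : Type*} [NormedAddCommGroup F]
    [NormedSpace ℝ F] {M : Type*} [TopologicalSpace M] [ChartedSpace E' M] {k : ℕ}
    (β : MForm 𝓘(ℝ, E') M F k) (W : TopologicalSpace.Opens M) :
    (β.pullback 𝓘(ℝ, E') (Subtype.val : W → M)).extendZero = β.restr (W : Set M) := by
  funext z
  by_cases hz : z ∈ W
  · ext v
    rw [MForm.extendZero_apply_of_mem _ hz, MForm.restr_apply_of_mem _ hz]
    exact MForm.pullback_subtypeVal_apply β ⟨z, hz⟩ v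
  · rw [MForm.extendZero_apply_of_notMem _ hz, MForm.restr_apply_of_notMem _ hz]

namespace AnalyticModel

/-- **The global holomorphic image restricts to the local ones**: for `X` affine with coordinates
`x₀`, an affine open `O ⊆ X` with coordinates `x`, a polynomial lift `F` of `O ↪ X` on them and
relations `I₀ · F ⊆ I`, cutting off the holomorphic image `regularFormRealize A x₀ hI₀ q r` on `X^an`
to the open piece `ψ⁻¹ O(ℂ)` gives the local realisation over `O` of `F^* r` — naturality of
Grothendieck's comparison map along `ι : X|_O ⟶ X` (`regularFormRealize_pullback_anMap`,
`anMap_restrictOpen_ι = Subtype.val`). [cite: Grothendieck1966, (5)–(6)] -/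
theorem restr_regularFormRealize [IsAffine X.left] [SmoothOfRelativeDimension m X.hom]
    (A : AnalyticModel E m X) {O : X.left.Opens} [IsAffine (Motives.openSubschemeOver X O).left]
    {N₀ N : ℕ} {x₀ : Fin N₀ → Γ(X.left, ⊤)} {x : Fin N → Γ((Motives.openSubschemeOver X O).left, ⊤)}
    {F : Fin N₀ → MvPolynomial (Fin N) ℂ}
    (hF : ∀ j, (Motives.openSubschemeOverι X O).left.appTop (x₀ j) =
      coordPresentation (Motives.openSubschemeOver X O) x (F j))
    {I₀ : Ideal (MvPolynomial (Fin N₀) ℂ)} {I : Ideal (MvPolynomial (Fin N) ℂ)}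
    (hI₀ : I₀ ≤ RingHom.ker (coordPresentation X x₀))
    (hI : I ≤ RingHom.ker (coordPresentation (Motives.openSubschemeOver X O) x))
    (hFI : I₀.map (bind₁ F : MvPolynomial (Fin N₀) ℂ →ₐ[ℂ] MvPolynomial (Fin N) ℂ) ≤ I)
    (q : ℕ) (r : RegularForm I₀ q) :
    (regularFormRealize A x₀ hI₀ q r).restr (A.openSet O : Set A.carrier) =
      A.realizeOn x hI q (RegularForm.comap F hFI q r) := by
  rw [A.realizeOn_apply, ← regularFormRealize_pullback_anMap (A.restrictOpen O) A
    (Motives.openSubschemeOverι X O) hF hI hI₀ hFI q r, A.anMap_restrictOpen_ι O]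
  exact (Literature.Geometry.Kaehler.MForm.extendZero_pullback_subtypeVal
    (regularFormRealize A x₀ hI₀ q r) (A.openSet O)).symm

end AnalyticModel

/-! ### The algebraic Čech–de Rham complex over `ℝ` -/

namespace CoverCharts

variable {U : ι → X.left.Opens} (C : CoverCharts X U)

/-- The algebraic Čech–de Rham double complex with scalars restricted to `ℝ` (the smooth complex
it maps to is a complex of real vector spaces). [cite: Weibel1994, 1.2.4] -/
def cechDeRhamℝ : ADoubleComplex ℝ C.Forms where
  d p q := (C.cechd p q).restrictScalars ℝ
  δ p q := (C.cechδ p q).restrictScalars ℝ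
  d_d p q c := C.cechDeRham.d_d p q c
  δ_δ p q c := C.cechDeRham.δ_δ p q c
  anticomm p q c := C.cechDeRham.anticomm p q c

/-- The vertical differential over `ℝ` is `cechd`. [cite: Weibel1994, 1.2.5] -/
theorem cechDeRhamℝ_d_apply (p q : ℕ) (c : C.Forms p q) : C.cechDeRhamℝ.d p q c = C.cechd p q c :=
  rfl

/-- The horizontal differential over `ℝ` is `cechδ`. [cite: BottTu1982Forms, §8 (8.4)] -/
theorem cechDeRhamℝ_δ_apply (p q : ℕ) (c : C.Forms p q) : C.cechDeRhamℝ.δ p q c = C.cechδ p q c :=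
  rfl

/-! ### The realisation morphism -/

variable (A : AnalyticModel E m X) [IsAffineCover U]

/-- **The realisation of algebraic Čech cochains as smooth Čech cochains**: componentwise, the
holomorphic image on the open piece `ψ⁻¹ U_J(ℂ)` read as a local form on `X^an`
(`AnalyticModel.localRealize` for the charts `x_J` and the canonical relations `ker φ_{x_J}`).
[cite: Grothendieck1966, p. 96 (6)] [cite: CattaniElZeinGriffithsLe2014, Ch. 2 §2.9.2 (p. 109)] -/
def realize (p q : ℕ) : C.Forms p q →ₗ[ℝ] CechForms 𝓘(ℝ, E) ℂ (A.coverSet U) p q where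
  toFun c J := ⟨A.realizeOn (C.coord J) le_rfl q (c J), by
    rw [A.cechSet_coverSet U J]
    exact A.realizeOn_mem_smoothFormsOn (C.coord J) le_rfl q (c J)⟩
  map_add' c c' := by
    funext J
    exact Subtype.ext (map_add (A.realizeOn (C.coord J) le_rfl q) (c J) (c' J))
  map_smul' a c := by
    funext J
    exact Subtype.ext (LinearMap.map_smul_of_tower (A.realizeOn (C.coord J) le_rfl q) a (c J))

/-- Components of the realisation, on underlying forms. [cite: Grothendieck1966, p. 96 (6)] -/
@[simp]
theorem coe_realize_apply (p q : ℕ) (c : C.Forms p q) (J : Fin (p + 1) → ι) :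
    (C.realize A p q c J : MForm 𝓘(ℝ, E) A.carrier ℂ q) = A.realizeOn (C.coord J) le_rfl q (c J) :=
  rfl

/-- **The realisation commutes with the vertical differentials** (`(-1)^p d` on both sides;
`regularFormRealize` is a cochain map, `localD_localRealize`). [cite: Grothendieck1966, (5)] -/
theorem realize_cechd (p q : ℕ) (c : C.Forms p q) :
    C.realize A p (q + 1) (C.cechd p q c) =
      Literature.Geometry.Kaehler.cechd 𝓘(ℝ, E) ℂ (A.isOpen_coverSet U) p q (C.realize A p q c) := by
  funext J
  apply Subtype.ext
  change A.realizeOn (C.coord J) le_rfl (q + 1) ((-1 : ℂ) ^ p • RegularForm.d (C.ideal J) (c J)) =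
    (-1 : ℝ) ^ p • (mextDeriv (A.realizeOn (C.coord J) le_rfl q (c J))).restr (cechSet (A.coverSet U) J)
  refine (map_smul (A.realizeOn (C.coord J) le_rfl (q + 1)) ((-1 : ℂ) ^ p) _).trans ?_
  have h := A.localD_localRealize (C.coord J) le_rfl q (c J)
  have h' := congrArg (fun s : smoothFormsOn 𝓘(ℝ, E) ℂ (A.openSet (cechOpen U J) : Set A.carrier) (q + 1) ↦
    (s : MForm 𝓘(ℝ, E) A.carrier ℂ (q + 1))) h
  change (mextDeriv (A.realizeOn (C.coord J) le_rfl q (c J))).restr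
      (A.openSet (cechOpen U J) : Set A.carrier) =
    A.realizeOn (C.coord J) le_rfl (q + 1) (RegularForm.d (C.ideal J) (c J)) at h'
  rw [← h', A.cechSet_coverSet U J]
  funext z
  ext v
  simp only [Pi.smul_apply, ContinuousAlternatingMap.smul_apply, smul_eq_mul, Complex.real_smul,
    Complex.ofReal_pow, Complex.ofReal_neg, Complex.ofReal_one]

variable [SmoothOfRelativeDimension m X.hom]

/-- **The realisation commutes with the Čech differentials**: realising `c_{J∘σ_j}|_{U_J}` is
restricting the realisation of `c_{J∘σ_j}` to the open piece over `U_J` (`restr_realizeOn`, the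
naturality of Grothendieck's comparison map along `U_J ⊆ U_{J∘σ_j}`).
[cite: Grothendieck1966, p. 96 (6)] [cite: CattaniElZeinGriffithsLe2014, Ch. 2 §2.9.2 (p. 109)] -/
theorem realize_cechδ (p q : ℕ) (c : C.Forms p q) :
    C.realize A (p + 1) q (C.cechδ p q c) =
      Literature.Geometry.Kaehler.cechδ 𝓘(ℝ, E) ℂ (A.isOpen_coverSet U) p q (C.realize A p q c) := by
  funext J
  apply Subtype.ext
  rw [Literature.Geometry.Kaehler.coe_cechδ_apply]
  change A.realizeOn (C.coord J) le_rfl q (∑ j : Fin (p + 2), (-1 : ℂ) ^ (j : ℕ) •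
      C.res J (Fin.succAbove j) q (c (J ∘ Fin.succAbove j))) =
    ∑ j : Fin (p + 2), (-1 : ℝ) ^ (j : ℕ) •
      (A.realizeOn (C.coord (J ∘ Fin.succAbove j)) le_rfl q (c (J ∘ Fin.succAbove j))).restr
        (cechSet (A.coverSet U) J)
  refine (map_sum (A.realizeOn (C.coord J) le_rfl q) _ _).trans (Finset.sum_congr rfl fun j _ ↦ ?_)
  refine (map_smul (A.realizeOn (C.coord J) le_rfl q) ((-1 : ℂ) ^ (j : ℕ)) _).trans ?_
  have key := AnalyticModel.restr_realizeOn (A := A) (cechOpen_le_comp U J (Fin.succAbove j))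
    (C.lift_spec J (Fin.succAbove j)) le_rfl le_rfl (C.map_lift_le J (Fin.succAbove j)) q
    (c (J ∘ Fin.succAbove j))
  refine (congrArg (fun (t : MForm 𝓘(ℝ, E) A.carrier ℂ q) ↦ (-1 : ℂ) ^ (j : ℕ) • t) key.symm).trans ?_
  rw [A.cechSet_coverSet U J]
  funext z
  ext v
  simp only [Pi.smul_apply, ContinuousAlternatingMap.smul_apply, smul_eq_mul, Complex.real_smul,
    Complex.ofReal_pow, Complex.ofReal_neg, Complex.ofReal_one]

/-- **The realisation is a morphism of double complexes** `Č(𝔘, Ω_alg) → Č(𝔘^an, Ω_smooth)`.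
[cite: Grothendieck1966, p. 96 (6)] [cite: CattaniElZeinGriffithsLe2014, Ch. 2 §2.9.2 (p. 109)] -/
def realizeHom :
    C.cechDeRhamℝ.Hom (Literature.Geometry.Kaehler.cechDeRham 𝓘(ℝ, E) ℂ (A.isOpen_coverSet U)) where
  f p q := C.realize A p q
  f_d p q c := C.realize_cechd A p q c
  f_δ p q c := C.realize_cechδ A p q c

/-- **The realisation on total cohomology** `Hⁿ(Tot Č(𝔘, Ω_alg)) → Hⁿ(Tot Č(𝔘^an, Ω_smooth))`.
[cite: Grothendieck1966, p. 96 (6)] -/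
def realizeTotCohMap (n : ℕ) :=
  (C.realizeHom A).totCohMap n

/-! ### Composition with the smooth edge isomorphism: the realisation map of Route P -/

/-- **The realisation map of Route P** (node P2): for a finite affine cover `𝔘` of `X` with charts
`C` and an analytic model `A` of `X`, the map
`Hⁿ(Tot Č(𝔘, Ω_alg)) → Hⁿ(Tot Č(𝔘^an, Ω)) ≅ Hⁿ(Ω•(X^an), d)` — algebraic Čech–de Rham classes
realised as de Rham classes of `X^an` (collation by a partition of unity).
[cite: Grothendieck1966, p. 96 (6)] [cite: CattaniElZeinGriffithsLe2014, Ch. 2 §2.9.2 (p. 109)] -/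
def realizeDeRham [Fintype ι] (hU : ⨆ i, U i = ⊤) (n : ℕ) :
    NatCochain.Cohomology C.cechDeRhamℝ.totD n →ₗ[ℝ]
      NatCochain.Cohomology
        (Literature.Geometry.Kaehler.cechDeRhamRow 𝓘(ℝ, E) ℂ (A.isOpen_coverSet U)).dA n :=
  (LinearEquiv.ofBijective _ (A.bijective_cechDeRhamRow_totMap U hU n)).symm.toLinearMap ∘ₗ
    C.realizeTotCohMap A n

/-- The realisation map followed by the smooth edge isomorphism is the map on total cohomology.
[cite: BottTu1982Forms, Prop. 8.8] -/
theorem totMap_realizeDeRham [Fintype ι] (hU : ⨆ i, U i = ⊤) (n : ℕ)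
    (c : NatCochain.Cohomology C.cechDeRhamℝ.totD n) :
    (Literature.Geometry.Kaehler.cechDeRhamRow 𝓘(ℝ, E) ℂ (A.isOpen_coverSet U)).totMap n
        (C.realizeDeRham A hU n c) = C.realizeTotCohMap A n c := by
  rw [realizeDeRham, LinearMap.comp_apply]
  exact (LinearEquiv.ofBijective _ (A.bijective_cechDeRhamRow_totMap U hU n)).apply_symm_apply _

end CoverCharts

end HodgeTheory

end Literature.AlgebraicGeometry.HodgeTheory

end
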